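import Mathlib.Analysis.Calculus.MeanValue
import Mathlib.Analysis.SpecialFunctions.Log.Deriv
import Mathlib.Analysis.SpecialFunctions.Log.NegMulLog
import Mathlib.Analysis.SpecialFunctions.Pow.Real
import HarnessLib

/-!
# Line-integration bootstrap: one-sided bounds for a function from bounds on its derivative with a singular majorant (Harish-Chandra ∕ Warner II §8.4.3)

Topic `Analysis/Calculus`; namespace `Literature.Analysis.Calculus.LineBootstrap`.  THEOREMS ONLY (no `def`, no instance, no notation, no axiom, no named fact, no `sorry`).
Cell `pub/hodgecm-mathlib`, ENGINE T1 (crux H413 = `stmt-HodgeConjecture-24833`); ROAD «A6-IV» (owner∕architect F0P3a-p05 (g15), DESIGN «(A6) IN-HOUSE» v2 = ARCHITECTURE (IV)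
«HARISH-CHANDRA ∕ WARNER BOOTSTRAP ON THE LIE ALGEBRA» 93542b84b04a2b0a, brick **(d1)** «LINE INTEGRATION BOOTSTRAP» [M, generic]; LEAD F0P3a-plan (g12) WORD T11-4 (3): pen F0P3a-p02 (g14)).
Author F0P3a-p02 (g14), 2026-09-01.

THE MATHEMATICS.  Step (S3) of Harish-Chandra's proof that the invariant integral has bounded derivatives on every chamber [WarnerHASSLG2, §8.4.3, Thm. 8.4.3.1, proof, cases (I) `m₀ ≥ 2`, (II) `m₀ = 1`;
Harish-Chandra, *Fourier transforms on a semisimple Lie algebra I*, Amer. J. Math. 79 (1957), §7 — mechanism named, nothing of it asserted] integrates the holonomic system along segments INSIDE a chamber, from a point near the singular wall out to the «far end» where everything is bounded,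
and lowers the exponent of the crude bound by one at each pass: `ρ ↦ ρ − 1 ↦ … ↦ 1 ↦ log ↦ bounded`.  This file is that one-variable engine, stated for a function `g : ℝ → E` on a parameter
segment `[0, S]` (`g s = v(θ + s•e)` in the application, `a = β(θ) > 0` the distance-to-the-wall coordinate, `β(θ + s•e) = a + s`):
* §1 `norm_le_norm_add_of_hasDerivAt_le` — the fundamental estimate from the FAR end with an explicit primitive `P` of the majorant `p`:
  `‖g′ s‖ ≤ p s = P′ s` on `[0, S]` ⇒ `‖g 0‖ ≤ ‖g S‖ + (P S − P 0)` (Mathlib `image_norm_le_of_norm_deriv_right_le_deriv_boundary'` applied to `x ↦ g (S − x)`);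
* §2 THE THREE PASSES: (ρ = n + 2 ↦ n + 1) `‖g′ s‖ ≤ M·((a+s)^{n+2})⁻¹ ⇒ ‖g 0‖ ≤ ‖g S‖ + (M∕(n+1))·(a^{n+1})⁻¹`; (ρ = 1 ↦ log) `‖g′ s‖ ≤ M·(a+s)⁻¹ ⇒ ‖g 0‖ ≤ ‖g S‖ + M·log((a+S)∕a)
  ≤ ‖g S‖ + M·(|log (a+S)| + |log a|)`; (log ↦ bounded, `a + S ≤ 1`) `‖g′ s‖ ≤ M·(1 + |log (a+s)|) ⇒ ‖g 0‖ ≤ ‖g S‖ + 3M`;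
* §3 the same three passes ALONG A LINE `s ↦ θ + s•e` in a real normed space `V` with a linear form `β` (`β e = 1`, `β θ = a > 0`), which is how brick (d2) «JET-BOUND BOOTSTRAP» consumes them on the six
  chambers of the angle chart (`β, β′` = the two noncompact roots, the `β′`-factor frozen along the segment into the constant `M`).
HONEST LABEL: HC_CM is proved only modulo the printed citations until rung 0 closes; generic real analysis, pays nothing by itself.

## References
* [WarnerHASSLG2] G. Warner, *Harmonic Analysis on Semi-Simple Lie Groups II* (1972), §8.4.3, Thm. 8.4.3.1 (proof, the integration along a line in the chamber), Appendix to §8.4.3 Lemma 2.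
* [Rudin1976] W. Rudin, *Principles of Mathematical Analysis*, 3rd ed. (1976), Thm. 5.19 ∕ 6.21 (mean value inequality for vector-valued functions; fundamental theorem of calculus).
-/

noncomputable section

open Set Filter Topology

namespace Literature.Analysis.Calculus.LineBootstrap

variable {E : Type*} [NormedAddCommGroup E] [NormedSpace ℝ E]

/-! ### §1 The fundamental estimate from the far end -/

/-- **FROM THE FAR END WITH AN EXPLICIT PRIMITIVE.**  If `g` has derivative `g′` on `[0, S]`, `P` has derivative `p` on `[0, S]` and `‖g′ s‖ ≤ p s` there, then
`‖g 0‖ ≤ ‖g S‖ + (P S − P 0)`. [cite: Rudin1976, Thm. 5.19] [cite: WarnerHASSLG2, §8.4.3 (proof of Thm. 8.4.3.1)] -/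
theorem norm_le_norm_add_of_hasDerivAt_le {g g' : ℝ → E} {P p : ℝ → ℝ} {S : ℝ} (hS : 0 ≤ S)
    (hg : ∀ s ∈ Icc (0 : ℝ) S, HasDerivAt g (g' s) s) (hP : ∀ s ∈ Icc (0 : ℝ) S, HasDerivAt P (p s) s)
    (bound : ∀ s ∈ Icc (0 : ℝ) S, ‖g' s‖ ≤ p s) :
    ‖g 0‖ ≤ ‖g S‖ + (P S - P 0) := by
  -- reflect: `h x = g (S - x)`, `B x = ‖g S‖ + (P S - P (S - x))`
  have hmem : ∀ x ∈ Icc (0 : ℝ) S, S - x ∈ Icc (0 : ℝ) S := fun x hx => ⟨by linarith [hx.2], by linarith [hx.1]⟩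
  have hrefl : ∀ x : ℝ, HasDerivAt (fun x : ℝ => S - x) (-1 : ℝ) x := fun x => by
    simpa using (hasDerivAt_id' x).const_sub S
  have hh : ∀ x ∈ Icc (0 : ℝ) S, HasDerivAt (fun x : ℝ => g (S - x)) ((-1 : ℝ) • g' (S - x)) x := fun x hx =>
    (hg (S - x) (hmem x hx)).scomp x (hrefl x)
  have hB : ∀ x ∈ Icc (0 : ℝ) S, HasDerivAt (fun x : ℝ => ‖g S‖ + (P S - P (S - x))) (p (S - x)) x := fun x hx => by
    have h1 : HasDerivAt (fun x : ℝ => P (S - x)) (p (S - x) * (-1 : ℝ)) x := (hP (S - x) (hmem x hx)).comp x (hrefl x)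
    have h2 := (h1.const_sub (P S)).const_add ‖g S‖
    exact h2.congr_deriv (by ring)
  have key := image_norm_le_of_norm_deriv_right_le_deriv_boundary' (f := fun x : ℝ => g (S - x)) (a := 0) (b := S)
    (f' := fun x => (-1 : ℝ) • g' (S - x)) (B := fun x : ℝ => ‖g S‖ + (P S - P (S - x))) (B' := fun x => p (S - x))
    (fun x hx => (hh x hx).continuousAt.continuousWithinAt)
    (fun x hx => (hh x (Ico_subset_Icc_self hx)).hasDerivWithinAt)
    (by simp) (fun x hx => (hB x hx).continuousAt.continuousWithinAt)
    (fun x hx => (hB x (Ico_subset_Icc_self hx)).hasDerivWithinAt)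
    (fun x hx => by
      rw [norm_smul, norm_neg, norm_one, one_mul]
      exact bound (S - x) (hmem x (Ico_subset_Icc_self hx)))
    (right_mem_Icc.2 hS)
  simpa using key

/-! ### §2 The three passes `ρ ↦ ρ − 1`, `1 ↦ log`, `log ↦ bounded` -/

/-- The primitive of `M·((a+s)^{n+2})⁻¹` used in the first pass: `s ↦ −(M∕(n+1))·((a+s)^{n+1})⁻¹`. [cite: Rudin1976, Thm. 5.19] -/
theorem hasDerivAt_neg_div_pow_succ {a M : ℝ} (n : ℕ) {s : ℝ} (has : 0 < a + s) :
    HasDerivAt (fun s : ℝ => -(M / (n + 1)) * ((a + s) ^ (n + 1))⁻¹) (M * ((a + s) ^ (n + 2))⁻¹) s := by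
  have h1 : HasDerivAt (fun s : ℝ => (a + s) ^ (n + 1)) (((n : ℝ) + 1) * (a + s) ^ n) s := by
    have h := ((hasDerivAt_id' s).const_add a).fun_pow (n + 1)
    refine h.congr_deriv ?_
    push_cast
    simp
  have hne : (a + s) ^ (n + 1) ≠ 0 := pow_ne_zero _ has.ne'
  have h2 := (h1.inv hne).const_mul (-(M / (n + 1)))
  refine h2.congr_deriv ?_
  have hn : ((n : ℝ) + 1) ≠ 0 := by positivity
  have has' : (a + s) ≠ 0 := has.ne'
  field_simp
  ring

/-- **FIRST PASS (`ρ = n + 2 ↦ n + 1`).**  `‖g′ s‖ ≤ M·((a+s)^{n+2})⁻¹` on `[0, S]` (`a > 0`) ⇒ `‖g 0‖ ≤ ‖g S‖ + (M∕(n+1))·(a^{n+1})⁻¹`.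
[cite: WarnerHASSLG2, §8.4.3 (proof of Thm. 8.4.3.1, case (I))] -/
theorem norm_le_of_norm_deriv_le_inv_pow {g g' : ℝ → E} {S a M : ℝ} (n : ℕ) (hS : 0 ≤ S) (ha : 0 < a) (hM : 0 ≤ M)
    (hg : ∀ s ∈ Icc (0 : ℝ) S, HasDerivAt g (g' s) s) (bound : ∀ s ∈ Icc (0 : ℝ) S, ‖g' s‖ ≤ M * ((a + s) ^ (n + 2))⁻¹) :
    ‖g 0‖ ≤ ‖g S‖ + M / (n + 1) * (a ^ (n + 1))⁻¹ := by
  have h := norm_le_norm_add_of_hasDerivAt_le hS hg (P := fun s : ℝ => -(M / (n + 1)) * ((a + s) ^ (n + 1))⁻¹)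
    (fun s hs => hasDerivAt_neg_div_pow_succ n (by linarith [hs.1])) bound
  have hpos : 0 ≤ M / (n + 1) * ((a + S) ^ (n + 1))⁻¹ := by positivity
  have e : (fun s : ℝ => -(M / (n + 1)) * ((a + s) ^ (n + 1))⁻¹) S - (fun s : ℝ => -(M / (n + 1)) * ((a + s) ^ (n + 1))⁻¹) 0 =
      M / (n + 1) * (a ^ (n + 1))⁻¹ - M / (n + 1) * ((a + S) ^ (n + 1))⁻¹ := by simp only [add_zero]; ring
  linarith

/-- **SECOND PASS (`ρ = 1 ↦ log`).**  `‖g′ s‖ ≤ M·(a+s)⁻¹` on `[0, S]` (`a > 0`) ⇒ `‖g 0‖ ≤ ‖g S‖ + M·log((a+S)∕a)`. [cite: WarnerHASSLG2, §8.4.3 (proof of Thm. 8.4.3.1, case (II))] -/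
theorem norm_le_of_norm_deriv_le_inv {g g' : ℝ → E} {S a M : ℝ} (hS : 0 ≤ S) (ha : 0 < a)
    (hg : ∀ s ∈ Icc (0 : ℝ) S, HasDerivAt g (g' s) s) (bound : ∀ s ∈ Icc (0 : ℝ) S, ‖g' s‖ ≤ M * (a + s)⁻¹) :
    ‖g 0‖ ≤ ‖g S‖ + M * Real.log ((a + S) / a) := by
  have hP : ∀ s ∈ Icc (0 : ℝ) S, HasDerivAt (fun s : ℝ => M * Real.log (a + s)) (M * (a + s)⁻¹) s := fun s hs => by
    have has : a + s ≠ 0 := by linarith [hs.1]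
    have h1 : HasDerivAt (fun s : ℝ => Real.log (a + s)) ((a + s)⁻¹) s :=
      (((hasDerivAt_id' s).const_add a).log has).congr_deriv (by simp)
    exact (h1.const_mul M)
  have h := norm_le_norm_add_of_hasDerivAt_le hS hg hP bound
  have e : M * Real.log (a + S) - M * Real.log (a + 0) = M * Real.log ((a + S) / a) := by
    rw [add_zero, Real.log_div (by linarith) ha.ne']; ring
  linarith

/-- The second pass in absolute-value form: `‖g 0‖ ≤ ‖g S‖ + M·(|log (a+S)| + |log a|)` (`M ≥ 0`). [cite: WarnerHASSLG2, §8.4.3 (proof of Thm. 8.4.3.1, case (II))] -/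
theorem norm_le_of_norm_deriv_le_inv' {g g' : ℝ → E} {S a M : ℝ} (hS : 0 ≤ S) (ha : 0 < a) (hM : 0 ≤ M)
    (hg : ∀ s ∈ Icc (0 : ℝ) S, HasDerivAt g (g' s) s) (bound : ∀ s ∈ Icc (0 : ℝ) S, ‖g' s‖ ≤ M * (a + s)⁻¹) :
    ‖g 0‖ ≤ ‖g S‖ + M * (|Real.log (a + S)| + |Real.log a|) := by
  have h := norm_le_of_norm_deriv_le_inv hS ha hg bound
  have hl : Real.log ((a + S) / a) ≤ |Real.log (a + S)| + |Real.log a| := by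
    rw [Real.log_div (by linarith) ha.ne']
    have e1 := le_abs_self (Real.log (a + S))
    have e2 := neg_abs_le (Real.log a)
    linarith
  nlinarith [mul_le_mul_of_nonneg_left hl hM]

/-- The primitive of `M·(1 − log(a+s))` used in the third pass: `s ↦ M·(2(a+s) − (a+s)·log(a+s))`. [cite: Rudin1976, Thm. 5.19] -/
theorem hasDerivAt_mul_two_mul_sub_mul_log {a M : ℝ} {s : ℝ} (has : 0 < a + s) :
    HasDerivAt (fun s : ℝ => M * (2 * (a + s) - (a + s) * Real.log (a + s))) (M * (1 - Real.log (a + s))) s := by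
  have hid : HasDerivAt (fun s : ℝ => a + s) 1 s := (hasDerivAt_id' s).const_add a
  have h1 : HasDerivAt (fun s : ℝ => (a + s) * Real.log (a + s)) ((Real.log (a + s) + 1) * 1) s :=
    (Real.hasDerivAt_mul_log has.ne').comp s hid
  have h2 := ((hid.const_mul 2).sub h1).const_mul M
  exact h2.congr_deriv (by ring)

/-- **THIRD PASS (`log ↦ bounded`).**  `‖g′ s‖ ≤ M·(1 + |log (a+s)|)` on `[0, S]` with `0 < a`, `a + S ≤ 1`, `M ≥ 0` ⇒ `‖g 0‖ ≤ ‖g S‖ + 3M`.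
[cite: WarnerHASSLG2, §8.4.3 (proof of Thm. 8.4.3.1, case (II), last step)] -/
theorem norm_le_of_norm_deriv_le_log {g g' : ℝ → E} {S a M : ℝ} (hS : 0 ≤ S) (ha : 0 < a) (h1 : a + S ≤ 1) (hM : 0 ≤ M)
    (hg : ∀ s ∈ Icc (0 : ℝ) S, HasDerivAt g (g' s) s) (bound : ∀ s ∈ Icc (0 : ℝ) S, ‖g' s‖ ≤ M * (1 + |Real.log (a + s)|)) :
    ‖g 0‖ ≤ ‖g S‖ + 3 * M := by
  have bound' : ∀ s ∈ Icc (0 : ℝ) S, ‖g' s‖ ≤ M * (1 - Real.log (a + s)) := fun s hs => by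
    have hle : Real.log (a + s) ≤ 0 := Real.log_nonpos (by linarith [hs.1]) (by linarith [hs.2])
    have hb := bound s hs
    rw [abs_of_nonpos hle] at hb
    simpa [sub_eq_add_neg] using hb
  have h := norm_le_norm_add_of_hasDerivAt_le hS hg (P := fun s : ℝ => M * (2 * (a + s) - (a + s) * Real.log (a + s)))
    (fun s hs => hasDerivAt_mul_two_mul_sub_mul_log (by linarith [hs.1])) bound'
  -- `P S − P 0 ≤ 3M`: `−u log u ≤ 1 − u` on `(0, 1]`... we use `-(u log u) ≤ 1∕e ≤ 1` via `Real.mul_log_..`? elementary: `−u·log u ≤ 1 − u ≤ 1`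
  have hu : ∀ u : ℝ, 0 < u → u ≤ 1 → -(u * Real.log u) ≤ 1 := fun u hu0 hu1 => by
    have := Real.add_one_le_exp (Real.log u⁻¹)
    have hlog : -Real.log u = Real.log u⁻¹ := by rw [Real.log_inv]
    -- `1 - log u ≤ 1/u`, i.e. `u - u log u ≤ 1`
    rw [Real.exp_log (inv_pos.2 hu0)] at this
    have h3 : u * (Real.log u⁻¹ + 1) ≤ u * u⁻¹ := mul_le_mul_of_nonneg_left this hu0.le
    rw [mul_inv_cancel₀ hu0.ne', Real.log_inv] at h3
    nlinarith
  have hA : -( (a + S) * Real.log (a + S)) ≤ 1 := hu (a + S) (by linarith) h1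
  have hB : 0 ≤ -(a * Real.log a) := by
    have : Real.log a ≤ 0 := Real.log_nonpos ha.le (by linarith)
    nlinarith
  have e : (fun s : ℝ => M * (2 * (a + s) - (a + s) * Real.log (a + s))) S - (fun s : ℝ => M * (2 * (a + s) - (a + s) * Real.log (a + s))) 0
      = M * ((2 * (a + S) - (a + S) * Real.log (a + S)) - (2 * a - a * Real.log a)) := by simp only [add_zero]; ring
  rw [e] at h
  have hin : (2 * (a + S) - (a + S) * Real.log (a + S)) - (2 * a - a * Real.log a) ≤ 3 := by nlinarith
  nlinarith

/-! ### §3 Along a line `θ + s•e` in a real normed space, with the distance-to-the-wall form `β` -/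

section Line

variable {V : Type*} [AddCommGroup V] [Module ℝ V]

/-- Along the segment `s ↦ θ + s•e` a linear form with `β e = 1` reads `β(θ + s•e) = β θ + s`. [cite: WarnerHASSLG2, §8.4.3] -/
theorem linearForm_add_smul (β : V →ₗ[ℝ] ℝ) (θ e : V) (hβe : β e = 1) (s : ℝ) : β (θ + s • e) = β θ + s := by
  simp [map_add, map_smul, hβe]

/-- **FIRST PASS ALONG A LINE** (`ρ = n + 2 ↦ n + 1`): if `s ↦ v(θ + s•e)` has derivative `w(θ + s•e)` on `[0, S]` with `‖w(θ + s•e)‖ ≤ M·(β(θ + s•e)^{n+2})⁻¹` (`β` linear, `β e = 1`,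
`β θ > 0` — the point `θ` lies in the chamber, `e` points away from the wall `β = 0`), then `‖v θ‖ ≤ ‖v(θ + S•e)‖ + (M∕(n+1))·(β θ^{n+1})⁻¹`.
[cite: WarnerHASSLG2, §8.4.3 (proof of Thm. 8.4.3.1, case (I))] -/
theorem norm_le_of_norm_lineDeriv_le_inv_pow (v w : V → E) (β : V →ₗ[ℝ] ℝ) (θ e : V) {S M : ℝ} (n : ℕ) (hβe : β e = 1) (hθ : 0 < β θ)
    (hS : 0 ≤ S) (hM : 0 ≤ M) (hv : ∀ s ∈ Icc (0 : ℝ) S, HasDerivAt (fun s : ℝ => v (θ + s • e)) (w (θ + s • e)) s)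
    (bound : ∀ s ∈ Icc (0 : ℝ) S, ‖w (θ + s • e)‖ ≤ M * ((β (θ + s • e)) ^ (n + 2))⁻¹) :
    ‖v θ‖ ≤ ‖v (θ + S • e)‖ + M / (n + 1) * ((β θ) ^ (n + 1))⁻¹ := by
  have h := norm_le_of_norm_deriv_le_inv_pow (g := fun s : ℝ => v (θ + s • e)) (g' := fun s => w (θ + s • e)) n hS hθ hM hv
    (fun s hs => by simpa only [linearForm_add_smul β θ e hβe s] using bound s hs)
  simpa using h

/-- **SECOND PASS ALONG A LINE** (`ρ = 1 ↦ log`): `‖w(θ + s•e)‖ ≤ M·(β(θ + s•e))⁻¹` on `[0, S]` ⇒ `‖v θ‖ ≤ ‖v(θ + S•e)‖ + M·(|log (β θ + S)| + |log (β θ)|)`.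
[cite: WarnerHASSLG2, §8.4.3 (proof of Thm. 8.4.3.1, case (II))] -/
theorem norm_le_of_norm_lineDeriv_le_inv (v w : V → E) (β : V →ₗ[ℝ] ℝ) (θ e : V) {S M : ℝ} (hβe : β e = 1) (hθ : 0 < β θ)
    (hS : 0 ≤ S) (hM : 0 ≤ M) (hv : ∀ s ∈ Icc (0 : ℝ) S, HasDerivAt (fun s : ℝ => v (θ + s • e)) (w (θ + s • e)) s)
    (bound : ∀ s ∈ Icc (0 : ℝ) S, ‖w (θ + s • e)‖ ≤ M * (β (θ + s • e))⁻¹) :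
    ‖v θ‖ ≤ ‖v (θ + S • e)‖ + M * (|Real.log (β θ + S)| + |Real.log (β θ)|) := by
  have h := norm_le_of_norm_deriv_le_inv' (g := fun s : ℝ => v (θ + s • e)) (g' := fun s => w (θ + s • e)) hS hθ hM hv
    (fun s hs => by simpa only [linearForm_add_smul β θ e hβe s] using bound s hs)
  simpa using h

/-- **THIRD PASS ALONG A LINE** (`log ↦ bounded`, inside the unit ball of the form: `β θ + S ≤ 1`): `‖w(θ + s•e)‖ ≤ M·(1 + |log β(θ + s•e)|)` on `[0, S]` ⇒ `‖v θ‖ ≤ ‖v(θ + S•e)‖ + 3M`.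
[cite: WarnerHASSLG2, §8.4.3 (proof of Thm. 8.4.3.1, case (II), last step)] -/
theorem norm_le_of_norm_lineDeriv_le_log (v w : V → E) (β : V →ₗ[ℝ] ℝ) (θ e : V) {S M : ℝ} (hβe : β e = 1) (hθ : 0 < β θ) (h1 : β θ + S ≤ 1)
    (hS : 0 ≤ S) (hM : 0 ≤ M) (hv : ∀ s ∈ Icc (0 : ℝ) S, HasDerivAt (fun s : ℝ => v (θ + s • e)) (w (θ + s • e)) s)
    (bound : ∀ s ∈ Icc (0 : ℝ) S, ‖w (θ + s • e)‖ ≤ M * (1 + |Real.log (β (θ + s • e))|)) :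
    ‖v θ‖ ≤ ‖v (θ + S • e)‖ + 3 * M := by
  have h := norm_le_of_norm_deriv_le_log (g := fun s : ℝ => v (θ + s • e)) (g' := fun s => w (θ + s • e)) hS hθ h1 hM hv
    (fun s hs => by simpa only [linearForm_add_smul β θ e hβe s] using bound s hs)
  simpa using h

end Line

end Literature.Analysis.Calculus.LineBootstrap

end
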